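import Summits.AtomisticToContinuum.Crystallization.Theses.ExcessDecayLiouville
import Literature.MathematicalPhysics.StatisticalMechanics.LennardJonesClusters

/-!
# Sketch — crux ideas for `FineGrains` (stmt-AtomisticToContinuum-9330; round 1, ideator 1)

First lemmas of the two idea cards as `Prop`s over existing declarations (statements only; nothing
here is claimed proved; no skeleton).

* Card `secant-bregman-fineness`:  `TubeEnergyCoercivity` (load-bearing, a certified-computation-sized
  energy inequality INSIDE the 1/40-tube) and `HereditarySlack` (provable now) with the documented chain
  `TubeEnergyCoercivity → HereditarySlack → CoarseGrains → FineGrains` (`SecantFineness`).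
* Card `chart-misfit-holonomy`:  `ChartEnergyCoercivity` (load-bearing, a LOCAL calibrated floor with a
  quadratic chart-misfit term, no global datum) and `AllGoodBalls` (the weaker geometric input), with the
  documented chain `∀ (a,h) θ₀, ChartEnergyCoercivity ha hh θ₀ → HereditarySlack → AllGoodBalls ha hh θ₀ → FineGrains`
  (`ChartFineness`; ONE cell and ONE tolerance shared by certificate and feeder).

Conventions are those of the route file `Theses/ExcessDecayLiouville.lean`: `Λ`, `Near`, `Adm`, `Inner`,
`Sites` are copied verbatim as standalone definitions; `Good` is the chart predicate of
`HcpDefectCounting.HcpDefectCoercivity` (stmt-14476) verbatim.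
-/

noncomputable section

open Literature.MathematicalPhysics.StatisticalMechanics

namespace Summit.AtomisticToContinuum.Crystallization.Cruxes.FineGrains.IdeatorOne

/-- `ℝ³`. -/
abbrev E3 := EuclideanSpace ℝ (Fin 3)

/-- The hexagonal period lattice `Λ = ℤu + ℤv + ℤ·2√(2/3)e₃` of the unit hcp stacking (route file, verbatim). -/
def Λ : Set E3 :=
  {z | ∃ i j k : ℤ, z = (i : ℝ) • triangularVec₁ 1 + (j : ℝ) • triangularVec₂ 1 +
    (k : ℝ) • layerNormal (2 * Real.sqrt (2 / 3))}

/-- Two-way `ε`-matching on the ball `dist · c ≤ r` with the affine hcp two-lattice `t_m + A(Λ)` (verbatim). -/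
def Near (X : Set E3) (c : E3) (r : ℝ) (t : Fin 2 → E3) (A : E3 →L[ℝ] E3) (ε : ℝ) : Prop :=
  (∀ p ∈ X, dist p c ≤ r → ∃ m : Fin 2, ∃ z ∈ Λ, dist p (t m + A z) ≤ ε) ∧
  (∀ m : Fin 2, ∀ z ∈ Λ, dist (t m + A z) c ≤ r → ∃ p ∈ X, dist p (t m + A z) ≤ ε)

/-- Admissible cell: within `1/40` (operator norm) of `0.97·O(3)` (verbatim). -/
def Adm (A : E3 →L[ℝ] E3) : Prop :=
  ∃ R : E3 ≃ₗᵢ[ℝ] E3, ‖A - (97 / 100 : ℝ) • (R.toContinuousLinearEquiv : E3 →L[ℝ] E3)‖ ≤ 1 / 40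

/-- hcp-like inner displacement (verbatim). -/
def Inner (t : Fin 2 → E3) (A : E3 →L[ℝ] E3) : Prop :=
  ‖t 1 - t 0 - A (barlowOffset 1 + layerNormal (Real.sqrt (2 / 3)))‖ ≤ 1 / 40

/-- The energy per particle in the thermodynamic limit, as an infimum: `e_∞ = inf_N E(N)/N`
(`= lim E(N)/N` by subadditivity, `BlancLewin2015_8_holds`; `≤ e(Q)` for every periodic `Q`). Using `e_∞`
as the reference constant makes the coercivity statements below WEAKER than (hence implied by) their versions
with the relaxed-hcp energy per particle, and is exactly what the slack chain consumes. -/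
def eInf : ℝ := ⨅ N : {N : ℕ // 0 < N}, groundStateEnergy lennardJones 3 (N : ℕ) / (N : ℕ)

/-- Internal Lennard-Jones energy of a finite point set (each pair once). -/
def clusterEnergy (X : Finset E3) : ℝ :=
  (∑ p ∈ X, ∑ q ∈ X, if p ≠ q then lennardJones (dist p q) else 0) / 2

/-! ## Card 1 — `secant-bregman-fineness` -/

/-- **HEREDITARY SLACK** (provable now; identical in content to `HereditaryAlmostMinimality` of the
CoarseGrains card `excise-and-recrystallise`): every ball of a Lennard-Jones ground state is a two-sided
`C·R²`-almost minimiser of its own particle number — `𝓔(x|_{B_R(c)}) ≤ E(n) + C R²`.  Proof: excise the `n`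
particles of the ball, re-create them far away as a near-ground state of `E(n)`, compare (minimality of `x`);
the only loss is the attraction across the sphere, `≤ C_δ R²` by `LennardJonesMinimalDistance_holds` +
`card_le_of_separated_of_dist_le` + the `r⁻⁶` tail. -/
def HereditarySlack : Prop :=
  ∃ C : ℝ, ∀ (N : ℕ) (x : Fin N → E3), IsGroundState lennardJones x →
    ∀ (c : E3) (R : ℝ), 0 < R → ∀ S : Finset (Fin N), (∀ i, i ∈ S ↔ dist (x i) c ≤ R) →
      interactionEnergy lennardJones (fun k : Fin S.card => x (S.orderEmbOfFin rfl k))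
        ≤ groundStateEnergy lennardJones 3 S.card + C * R ^ 2

/-- **TUBE ENERGY COERCIVITY** (the load-bearing first lemma of card 1; an elasticity inequality INSIDE
the plastic-free tube, certified-computation-sized).  There are `κ > 0` and `C` such that for every
admissible datum `(t, A)` with hcp-like inner shift and every finite configuration `Y` two-way
`1/40`-matched with `t_m + A(Λ)` on `B_{R+2}(c)`, with `(μ, ζ)` any labelling of the particles by their
(unique) `1/40`-close sites `t (μ p) + A (ζ p)`, the internal energy of `X = Y ∩ B_R(c)` controls the
squared deviation of ALL nearest-neighbour bond vectors from ONE affine image of the reference bonds, up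
to free sublattice translations:
`#X · e_∞ + κ · Σ_{p,q ∈ X, 0 < |p−q| ≤ 11/10} ‖(p − q) − L(A(ζ p − ζ q)) − (τ(μ p) − τ(μ q))‖² ≤ 𝓔(X) + C R²`
for some linear `L` and `τ : Fin 2 → ℝ³`.  Mechanism (card): Bregman split of the pair energy in SQUARED
bond lengths around the zero-stress relaxed two-lattice — `φ(s) = s⁻⁶/12 − s⁻³/6` is convex for
`s < (7/4)^{1/3}` (r < 1.098), which contains every nearest-neighbour bond of the tube, so the radial
anharmonicity never enters a LOWER bound; the linear terms are null Lagrangians (flux `O(R²)` by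
equilibrium AND zero stress); what is left is the quadratic form of ONE softened harmonic comparison
two-lattice, whose Bloch positivity (a 6×6 family, certified like `PhononStability` 9333) is `κ`. -/
def TubeEnergyCoercivity : Prop :=
  ∃ κ C : ℝ, 0 < κ ∧ ∀ (t : Fin 2 → E3) (A : E3 →L[ℝ] E3), Adm A → Inner t A →
    ∀ (c : E3) (R : ℝ), 0 < R → ∀ Y : Finset E3, Near (↑Y : Set E3) c (R + 2) t A (1 / 40) →
      ∀ (μ : E3 → Fin 2) (ζ : E3 → E3),
        (∀ p ∈ Y, dist p c ≤ R + 2 → ζ p ∈ Λ ∧ dist p (t (μ p) + A (ζ p)) ≤ 1 / 40) →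
        ∃ (L : E3 →L[ℝ] E3) (τ : Fin 2 → E3),
          ((Y.filter fun p => dist p c ≤ R).card : ℝ) * eInf +
            κ * (∑ p ∈ Y.filter (fun p => dist p c ≤ R), ∑ q ∈ Y.filter (fun p => dist p c ≤ R),
              if p ≠ q ∧ dist p q ≤ 11 / 10 then
                ‖(p - q) - (L (A (ζ p - ζ q)) + (τ (μ p) - τ (μ q)))‖ ^ 2 else 0)
          ≤ clusterEnergy (Y.filter fun p => dist p c ≤ R) + C * R ^ 2

/-- The documented chain of card 1 (a `Prop`, not a theorem: no skeleton at this stage).  Content of the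
implication: pigeonhole over `ρ`-sub-balls of the coarse `R(ρ, ε)`-grain + path integration of the
nearest-neighbour bond vectors (connected NN graph of the two-lattice), with `E(n) ≤ n(e_∞ + η)`
(`stub_trialBound`, `BlancLewin2015_8_holds`) closing the slack sandwich. -/
def SecantFineness : Prop :=
  TubeEnergyCoercivity → HereditarySlack →
    Theses.ExcessDecayLiouville.CoarseGrains → Theses.ExcessDecayLiouville.FineGrains

/-! ## Card 2 — `chart-misfit-holonomy` -/

/-- The radius-`ρ`, tolerance-`η` hcp CHART predicate of `HcpDefectCounting.HcpDefectCoercivity`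
(stmt-14476), verbatim: an origin-based linear isometry `A` two-way `η`-matches the `ρ`-neighbourhood of
`x i` with `x i + A(hcp a h ∩ B_ρ)` (hcp is vertex-transitive, so origin charts lose nothing). -/
def Good {a h : ℝ} (ha : a ≠ 0) (hh : h ≠ 0) {N : ℕ} (x : Fin N → E3) (ρ η : ℝ) (i : Fin N) : Prop :=
  ∃ A : E3 →ₗᵢ[ℝ] E3,
    (∀ p ∈ (hcpPeriodicConfiguration ha hh).points, ‖p‖ ≤ ρ → ∃ j : Fin N, dist (x j) (x i + A p) ≤ η) ∧
    (∀ j : Fin N, dist (x j) (x i) ≤ ρ →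
      ∃ p ∈ (hcpPeriodicConfiguration ha hh).points, dist (x j) (x i + A p) ≤ η)

/-- **CHART ENERGY COERCIVITY** (the load-bearing first lemma of card 2; a LOCAL calibrated floor — no
global affine datum, no Bloch).  Parameters: hcp cell `(a, h)` (meant: the relaxed LJ cell; for any other cell the
statement is false, as it should be) and a FIXED chart tolerance `θ₀`.  There are `κ > 0` and `C` such that: for an ARBITRARY finite
configuration `x` (no minimality) all of whose particles within `R + 8` of `c` carry a `θ₀`-good radius-`4` hcp
chart, the INTERNAL energy of the sub-cluster `x|_{B_R(c)}` exceeds `n · e(hcp a h)` by `κ` times the summed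
SQUARED BEST CHART MISFITS, up to a surface term:
`n·e(hcp a h) + κ Σ_{i ∈ B_R(c)} θ(i)² ≤ 𝓔(x|_{B_R(c)}) + C R²` for every admissible misfit assignment `θ(i)`
(`Good 4 (θ i) i`).  Internal energy only, so matter outside `B_{R+8}` is irrelevant (as in `HereditarySlack`).
Mechanism (card): a discrete null-Lagrangian (bond/cell-transfer) calibration of the site energy on the finitely
many `θ₀`-tube local environments (the tet–oct honeycomb cells of card `cell-determinant-convexification`@9332, used
for a FLOOR inequality with quadratic misfit gain, not for convexity), radial anharmonicity removed by the Bregman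
split in squared lengths, far field inside the good region split into flux (linear) + an absorbed quadratic part. -/
def ChartEnergyCoercivity {a h : ℝ} (ha : a ≠ 0) (hh : h ≠ 0) (θ₀ : ℝ) : Prop :=
  ∃ κ C : ℝ, 0 < κ ∧ ∀ (N : ℕ) (x : Fin N → E3) (c : E3) (R : ℝ), 0 < R →
    (∀ i : Fin N, dist (x i) c ≤ R + 8 → Good ha hh x 4 θ₀ i) →
    ∀ θ : Fin N → ℝ, (∀ i : Fin N, dist (x i) c ≤ R → 0 ≤ θ i ∧ Good ha hh x 4 (θ i) i) →
    ∀ S : Finset (Fin N), (∀ i, i ∈ S ↔ dist (x i) c ≤ R) →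
      (S.card : ℝ) * (hcpPeriodicConfiguration ha hh).energyPerParticle lennardJones +
          κ * (∑ i ∈ S, (θ i) ^ 2)
        ≤ interactionEnergy lennardJones (fun k : Fin S.card => x (S.orderEmbOfFin rfl k)) + C * R ^ 2

/-- ALL-GOOD BALLS at a FIXED chart tolerance `θ₀` (the weaker geometric input of card 2; implied by
`CoarseGrains` for `θ₀ ≥ C/40`, and by defect COUNTING `#{¬Good 4 θ₀} ≤ C N^{2/3}` (stmt-14476 + 14477)
through a pigeonhole over `N/R³ ≫ N^{2/3}` disjoint balls — no propagation / chart-gluing to a global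
affine datum is asked). -/
def AllGoodBalls {a h : ℝ} (ha : a ≠ 0) (hh : h ≠ 0) (θ₀ : ℝ) : Prop :=
  ∀ R : ℝ, 0 < R → ∃ N₀ : ℕ, ∀ N : ℕ, N₀ ≤ N → ∀ x : Fin N → E3, IsGroundState lennardJones x →
    ∃ c : E3, ∀ i : Fin N, dist (x i) c ≤ R → Good ha hh x 4 θ₀ i

/-- The documented chain of card 2 (a `Prop`, not a theorem).  Content: slack sandwich
(`𝓔(x|_{B_R}) ≤ E(n) + C R² ≤ n·e(hcp a h) + C′n^{2/3} + C R²`, block trial states) gives `Σ θ(i)² ≤ C″R²/κ`;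
pigeonhole gives a `ρ′`-sub-ball on which EVERY best misfit is `≤ s = (C′ρ′³/(κR))^{1/2}`; overlapping
radius-`4` charts at misfit `s` agree up to `C s` modulo the hcp space group, so chart holonomy along paths
of length `≤ ρ′` drifts by `≤ C ρ′ s` and the glued chart is an affine hcp two-lattice `ε`-matching the
sub-ball once `R ≥ C ρ′⁷/(κ ε²)` — an elementary substitute for Friesecke–James–Müller rigidity. -/
def ChartFineness : Prop :=
  ∀ (a h : ℝ) (ha : a ≠ 0) (hh : h ≠ 0) (θ₀ : ℝ), 47 / 50 ≤ a → a ≤ 1 → 39 / 50 * a ≤ h → h ≤ 17 / 20 * a →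
    0 < θ₀ → ChartEnergyCoercivity ha hh θ₀ → HereditarySlack → AllGoodBalls ha hh θ₀ →
      Theses.ExcessDecayLiouville.FineGrains

end Summit.AtomisticToContinuum.Crystallization.Cruxes.FineGrains.IdeatorOne

end
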